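import Literature.AlgebraicGeometry.Morphisms.NagataCompactificationProofs
import Literature.AlgebraicGeometry.Resolution.BlowupReducedDimension
import Literature.AlgebraicGeometry.Motives.AbelianVarietyIsogenyProofs
import Literature.AlgebraicGeometry.Resolution.BlowupsIntegral
import Literature.AlgebraicGeometry.Resolution.ResolutionOfSingularities
import Mathlib.Topology.KrullDimension
import Mathlib.RingTheory.Spectrum.Prime.Topology
import HarnessLib

/-!
# Crux `Picover` (stmt-ResolutionOfSingularities-0554), line `degree-p-tower`, stub
# `topologicalKrullDim_le_of_isProper_of_isBirational`: a proper birational scheme over a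
# Noetherian domain has dimension at most that of the domain

Support file (`--supports stmt-ResolutionOfSingularities-0554`) for the weak frame of the stub plan
of line `degree-p-tower` (fallback FB2): Cossart–Piltant applies to a proper birational
`S' → Spec 𝒪_{X,x}` only once `dim S' ≤ dim 𝒪_{X,x} ≤ 3` is known. This file proves that bound in
general:

* `topologicalKrullDim_le_of_isProper_of_isBirational` — for `R` a Noetherian domain, `S'` integral
  and `g : S' → Spec R` proper and birational, `dim S' ≤ dim R`.

Proof. Birationality gives a dense open `U ⊆ Spec R` over which `g` is an isomorphism; `U` is
compact (`Spec R` is a Noetherian space). Raynaud–Gruson (`exists_isBlowup_dominating`, Stacks 081T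
with 080E, proved in tree) dominates `g` by the blow-up `b : S₁ → Spec R` along an ideal sheaf `I`
with `Supp I = Uᶜ`, together with a blow-up `r : S₁ → S'` along `I𝒪_{S'}` and `r ≫ g = b`. The
ideal `I𝒪_{S'}` is non-zero: `U` is a dense open of the non-empty `Spec R`, so some point of `S'`
maps into `U = (Supp I)ᶜ`, whereas `Supp (0) = S'`. Hence `r` is a blow-up of the integral
locally Noetherian `S'` along a non-zero ideal: proper and birational, so dominant and closed, so
surjective, whence `dim S' ≤ dim S₁` (closed surjections do not lower dimension). Finally
`dim S₁ ≤ dim Spec R = dim R` since blowing up a locally Noetherian scheme does not raise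
codimensions of points (`IsBlowup.coheight_le_of_isLocallyNoetherian`, Matsumura Thm. 15.5).

No new definitions, no named facts. [cite: StacksProject, Tags 081T, 080E, 02ND]
[cite: Matsumura1987, Thm. 15.5]
-/

noncomputable section

open CategoryTheory CategoryTheory.Limits AlgebraicGeometry TopologicalSpace IsLocalRing
open Literature.AlgebraicGeometry.Resolution Literature.AlgebraicGeometry.Morphisms

set_option linter.dupNamespace false -- mandated namespace of this single-conjunct summit

namespace Summit.ResolutionOfSingularities.ResolutionOfSingularities.Theorems.Picover.ProperBirationalDimension

universe u

/-- **Blowing up a locally Noetherian scheme does not raise the dimension** (no numeric bound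
needed): for a blow-up `π : X' → X` of a locally Noetherian scheme, `dim X' ≤ dim X`, because
`codim x' ≤ codim (π x')` for every `x' ∈ X'` (`IsBlowup.coheight_le_of_isLocallyNoetherian`) and
the dimension of a scheme is the supremum of the codimensions of its points.
[cite: Matsumura1987, Thm. 15.5] -/
theorem topologicalKrullDim_le_of_isBlowup {X' X : Scheme.{u}} [IsLocallyNoetherian X]
    {π : X' ⟶ X} {J : X.IdealSheafData} (hπ : IsBlowup π J) :
    topologicalKrullDim X' ≤ topologicalKrullDim X := by
  rw [topologicalKrullDim_eq_krullDim_carrier, topologicalKrullDim_eq_krullDim_carrier,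
    Order.krullDim_eq_iSup_coheight, Order.krullDim_eq_iSup_coheight]
  exact iSup_le fun x' => le_iSup_of_le (π.base x')
    (WithBot.coe_le_coe.mpr (hπ.coheight_le_of_isLocallyNoetherian x'))

/-- **A proper birational scheme over a Noetherian domain has dimension at most that of the
domain** (registered helper stub `topologicalKrullDim_le_of_isProper_of_isBirational` of
stmt-ResolutionOfSingularities-0554, line `degree-p-tower`): for `R` a Noetherian domain, `S'` an
integral scheme and `g : S' → Spec R` proper and birational, `dim S' ≤ dim R`. Proof: Raynaud–Gruson
(`exists_isBlowup_dominating`) dominates `g` by a blow-up `b : S₁ → Spec R` through a blow-up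
`r : S₁ → S'` along a non-zero ideal; `r` is proper birational, hence surjective, so
`dim S' ≤ dim S₁ ≤ dim Spec R = dim R`. [cite: StacksProject, Tags 081T, 080E, 02ND]
[cite: Matsumura1987, Thm. 15.5] -/
theorem topologicalKrullDim_le_of_isProper_of_isBirational : ∀ (R : Type u) [CommRing R] [IsDomain R] [IsNoetherianRing R] (S' : Scheme.{u}) [IsIntegral S'] (g : S' ⟶ Spec (.of R)) [IsProper g], IsBirational g → topologicalKrullDim S' ≤ ringKrullDim R := by
  intro R _ _ _ S' _ g _ hg
  classical
  haveI : IsNoetherianRing (CommRingCat.of R) := inferInstanceAs (IsNoetherianRing R)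
  haveI : IsNoetherian (Spec (CommRingCat.of R)) := {}
  haveI : Nonempty (Spec (CommRingCat.of R)) := inferInstanceAs (Nonempty (PrimeSpectrum R))
  haveI : IsLocallyNoetherian S' := LocallyOfFiniteType.isLocallyNoetherian g
  -- Step 1: the dense open `U ⊆ Spec R` over which `g` is an isomorphism; it is compact
  obtain ⟨U, hUd, -, hiso⟩ := hg
  haveI := hiso
  -- Step 2: Raynaud–Gruson (Stacks 081T + 080E): `b : S₁ → Spec R` blow-up along `I`,
  -- `Supp I = Uᶜ`, dominating `S'` by a blow-up `r : S₁ → S'` along `I.comap g`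
  obtain ⟨I, S₁, b, r, -, hIsupp, hb, hrb, hr⟩ :=
    exists_isBlowup_dominating g U (TopologicalSpace.NoetherianSpace.isCompact _)
  -- Step 3: `I.comap g ≠ ⊥`: some point of `S'` maps into the non-empty `U = (Supp I)ᶜ`
  have hJ : I.comap g ≠ ⊥ := by
    intro h0
    obtain ⟨s, hsU⟩ := hUd.nonempty
    obtain ⟨z, hz⟩ := (ConcreteCategory.bijective_of_isIso (g ∣_ U).base).2 ⟨s, hsU⟩
    have hgz : g ((g ⁻¹ᵁ U).ι z) = s := by
      have := morphismRestrict_base_coe g U z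
      rw [hz] at this
      exact this.symm
    have hmem : (g ⁻¹ᵁ U).ι z ∈ ((I.comap g).support : Set S') := by
      rw [h0, Scheme.IdealSheafData.support_bot]; trivial
    rw [Scheme.IdealSheafData.support_comap] at hmem
    have hmem' : g ((g ⁻¹ᵁ U).ι z) ∈ (I.support : Set (Spec (CommRingCat.of R))) := hmem
    rw [hgz, hIsupp] at hmem'
    exact hmem' hsU
  -- Step 4: `r` is a proper birational morphism onto the integral `S'`, hence surjective
  haveI : IsProper r := hr.isProper
  haveI : IsDominant r := (hr.isBirational' hJ).isDominant
  haveI : Surjective r := surjective_of_isDominant_of_isClosed_range r r.isClosedMap.isClosed_range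
  -- Step 5: `dim S' ≤ dim S₁ ≤ dim Spec R = dim R`
  calc topologicalKrullDim S' ≤ topologicalKrullDim S₁ :=
        Literature.AlgebraicGeometry.Motives.Scheme.topologicalKrullDim_le_of_universallyClosed_of_surjective r
    _ ≤ topologicalKrullDim (Spec (CommRingCat.of R)) := topologicalKrullDim_le_of_isBlowup hb
    _ = ringKrullDim R := PrimeSpectrum.topologicalKrullDim_eq_ringKrullDim R

end Summit.ResolutionOfSingularities.ResolutionOfSingularities.Theorems.Picover.ProperBirationalDimension

end
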